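import Summits.AtomisticToContinuum.HydrodynamicLimit.Theorems.BoxDissipativeWeakStrongRelativeEnergyStabilityCutEosMasterHelpers
import Summits.AtomisticToContinuum.HydrodynamicLimit.Theorems.BoxDissipativeWeakStrongRelativeEnergyStabilityCutEosMasterTransferHelpers
import HarnessLib

/-!
# Crux `RelativeEnergyStability` (stmt-AtomisticToContinuum-17653), line `registered`: stub `stub_cutEosMaster`

**S-M — BF's master pointwise inequality for the CUT hard-sphere law with a deep clamp.** Under
`HsEosLowDensity` there is `ηm > 0` such that for every band `η₁ < ηm` and every `σ > 0`,
`CutEosMasterFor σ η₁` holds: for `K ⊂ {r > 0, rσ³ < η₁, Θ > 0}` compact, data bounded by `M`, clamps `a < b`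
inactive on a `δ`-box around `K` and deep on `K` (`μ_cut + Θa ≤ −1`), `reducedRHS ≤ C·ℰ_{Z_{a,b}}` for all point
data over `K` obeying the mass and temperature equations and every state that is vacuum or in the open quadrant
(BrezinaFeireisl2018 §3.2.2 (3.9)–(3.11)).

Proof (`cm_cutEosMasterFor`), four regions. `ηm` is chosen so that `Z_cut ∈ (1/2, 3/2)`, `(ηZ)' ≥ 1/2` on the
band, and the band lies inside that of the `σ`-uniform smooth extension `monatomicExcess χ f`
(`cm_band_extension`). The reduced right-hand side is bounded linearly,
`reducedRHS ≤ N(ρ|v|² + ρ + 1 + E)` (`cm_reducedRHS_le_lin`, `|p_cut| ≤ E`). (V) vacuum: `reducedRHS ≤ N`,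
`ℰ_Z = p_cut(r,Θ) ≥ p_min > 0`. (C) `{s < a}`: the deep clamp gives `ℰ_Z ≥ ½ρ|v|² + E + ρ + p_min`.
(E) the `min(δ, δ_B)`-box: both clamps are inactive and the cut law agrees with the extension to first order at
`(r,Θ)` and in value at the state, so `reducedRHS` and `relEnergyFull = ℰ_Z` are those of the extension
(`cm_state_transfer`) and `master_pointwise_inequality` for the extension applies. (R) elsewhere with `s ≥ a`:
`ℰ_Z ≥ relEnergyFull = ½ρ|v|² + R_cut` and `R_cut ≥ ½ R_ideal` (`cm_relEnergyThermo_cut_ge`), while the ideal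
gas enjoys BF's residual coercivity and growth bounds (`relEnergyThermo_coercivity_near_far`,
`density_le_of_relEnergyThermo`, `energy_entropy_le_of_relEnergyThermo`).

References: BrezinaFeireisl2018 §3.2; FeireislNovotny2012 §3; Dafermos1979.
-/

noncomputable section

namespace Summit.AtomisticToContinuum.HydrodynamicLimit.Theorems.RES

open MeasureTheory Filter Set Metric
open scoped Topology
open Summit.AtomisticToContinuum.HydrodynamicLimit.Theses.BoxDissipativeWeakStrong
open Literature.MathematicalPhysics.KineticTheory Literature.Analysis.FluidPDE
open Literature.Analysis.FluidPDE.CompressibleEuler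
open Literature.Analysis.FluidPDE.CompressibleEuler.EulerPhase
open Literature.Analysis.FluidPDE.CompressibleEuler.StrongPointData

/-! ## Arithmetic of the four regions -/

/-- Arithmetic of the linear bound: `A₁(2K) + A₂ρ + A₃ + 3ME ≤ N (2K + ρ + 1 + E)` with
`N = A₁ + A₂ + A₃ + 3M + 1`. -/
theorem cm_arith_lin {A₁ A₂ A₃ M Kin ρ E : ℝ} (hA₁ : 0 ≤ A₁) (hA₂ : 0 ≤ A₂) (hA₃ : 0 ≤ A₃) (hM : 0 ≤ M)
    (hKin : 0 ≤ Kin) (hρ : 0 ≤ ρ) (hE : 0 ≤ E) :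
    A₁ * (2 * Kin) + A₂ * ρ + A₃ + 3 * M * E ≤ (A₁ + A₂ + A₃ + 3 * M + 1) * (2 * Kin + ρ + 1 + E) := by
  nlinarith [mul_nonneg hA₁ hρ, mul_nonneg hA₁ hE, mul_nonneg hA₂ hKin, mul_nonneg hA₂ hE,
    mul_nonneg hA₃ hKin, mul_nonneg hA₃ hρ, mul_nonneg hA₃ hE, mul_nonneg hM hKin, mul_nonneg hM hρ]

/-- Arithmetic of the cold region `{s < a}`: the deep clamp makes `ℰ_Z ≥ K + E + ρ + p_min`. -/
theorem cm_arith_cold {Kin E ρ pmin X : ℝ} (hKin : 0 ≤ Kin) (hE : 0 ≤ E) (hρ : 0 ≤ ρ) (hpmin : 0 < pmin)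
    (hX : Kin + E + ρ + pmin ≤ X) : 2 * Kin + ρ + 1 + E ≤ 2 * (1 + 1 / pmin) * X := by
  have h1 : 1 ≤ (1 + 1 / pmin) * pmin := by
    rw [add_mul, one_div, inv_mul_cancel₀ hpmin.ne']; linarith
  have h2 : 1 ≤ 1 + 1 / pmin := by
    have : 0 ≤ 1 / pmin := by positivity
    linarith
  have h3 := mul_le_mul_of_nonneg_left hX (zero_le_one.trans h2)
  have h4 : (1 + 1 / pmin) * (Kin + E + ρ + pmin) = (1 + 1 / pmin) * Kin + (1 + 1 / pmin) * E +
      (1 + 1 / pmin) * ρ + (1 + 1 / pmin) * pmin := by ring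
  have e1 := mul_le_mul_of_nonneg_right h2 hKin
  have e2 := mul_le_mul_of_nonneg_right h2 hE
  have e3 := mul_le_mul_of_nonneg_right h2 hρ
  have e4 : 0 ≤ (1 + 1 / pmin) * X := by nlinarith
  linarith

/-- Arithmetic of the residual region (BF (3.8)): `R₀ ≥ c₁`, `ρ ≤ C_d(1 + R₀)`, `E ≤ C_e(1 + ρ + R₀)` give
`2K + ρ + 1 + E ≤ C_r (K + R₀/2)`. -/
theorem cm_arith_far {Kin E ρ R₀ c₁ Cd Ce X : ℝ} (hKin : 0 ≤ Kin) (hc₁ : 0 < c₁) (hCd : 0 ≤ Cd)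
    (hCe : 0 ≤ Ce) (hR : c₁ ≤ R₀) (hρC : ρ ≤ Cd * (1 + R₀)) (hEC : E ≤ Ce * (1 + ρ + R₀))
    (hX : Kin + R₀ / 2 ≤ X) :
    2 * Kin + ρ + 1 + E ≤ (2 + 2 * ((1 + Ce) * (1 + Cd) + Ce) * (1 / c₁ + 1)) * X := by
  have hR0 : 0 ≤ R₀ := hc₁.le.trans hR
  set G : ℝ := (1 + Ce) * (1 + Cd) + Ce with hG
  have hG0 : 0 ≤ G := by positivity
  -- `ρ + 1 + E ≤ G (1 + R₀)`
  have h1 : ρ + 1 + E ≤ G * (1 + R₀) := by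
    have e1 : (1 + Ce) * (1 + ρ) ≤ (1 + Ce) * ((1 + Cd) * (1 + R₀)) :=
      mul_le_mul_of_nonneg_left (by nlinarith) (by positivity)
    have e2 : ρ + 1 + E ≤ (1 + Ce) * (1 + ρ) + Ce * R₀ := by nlinarith
    have e3 : Ce * R₀ ≤ Ce * (1 + R₀) := mul_le_mul_of_nonneg_left (by linarith) hCe
    calc ρ + 1 + E ≤ (1 + Ce) * ((1 + Cd) * (1 + R₀)) + Ce * (1 + R₀) := by linarith
      _ = G * (1 + R₀) := by rw [hG]; ring
  -- `1 + R₀ ≤ (1/c₁ + 1) R₀`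
  have h2 : 1 + R₀ ≤ (1 / c₁ + 1) * R₀ := by
    have : 1 ≤ 1 / c₁ * R₀ := by
      rw [one_div, ← div_eq_inv_mul, le_div_iff₀ hc₁]; linarith
    linarith
  have h3 : G * (1 + R₀) ≤ G * ((1 / c₁ + 1) * R₀) := mul_le_mul_of_nonneg_left h2 hG0
  have h4 : 0 ≤ G * (1 / c₁ + 1) := by positivity
  have h5 : Kin ≤ X - R₀ / 2 := by linarith
  nlinarith [h1, h3, h4, h5, mul_nonneg h4 hKin]

/-- The residual coercivity off a smaller box: local quadratic coercivity on the `δ₀`-box and `c₀` off it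
give `min c₀ (c₀ δₛ²)` off the `δₛ`-box. -/
theorem cm_far_coercive {c₀ δs δ₀ R₀ x y : ℝ} (hc₀ : 0 < c₀) (hδs : 0 < δs)
    (hnear : |x| ≤ δ₀ → |y| ≤ δ₀ → c₀ * (x ^ 2 + y ^ 2) ≤ R₀)
    (hfar : δ₀ ≤ |x| ∨ δ₀ ≤ |y| → c₀ ≤ R₀) (hout : ¬(|x| ≤ δs ∧ |y| ≤ δs)) :
    min c₀ (c₀ * δs ^ 2) ≤ R₀ := by
  by_cases hfar₁ : δ₀ ≤ |x| ∨ δ₀ ≤ |y|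
  · exact (min_le_left _ _).trans (hfar hfar₁)
  · rcases not_or.1 hfar₁ with ⟨h1, h2⟩
    have hloc := hnear (le_of_lt (not_le.1 h1)) (le_of_lt (not_le.1 h2))
    refine (min_le_right _ _).trans (le_trans ?_ hloc)
    refine mul_le_mul_of_nonneg_left ?_ hc₀.le
    rcases not_and_or.1 hout with h | h
    · have h3 : δs ^ 2 ≤ x ^ 2 := by
        rw [← sq_abs x]; exact pow_le_pow_left₀ hδs.le (le_of_lt (not_le.1 h)) 2
      linarith only [h3, sq_nonneg y]
    · have h3 : δs ^ 2 ≤ y ^ 2 := by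
        rw [← sq_abs y]; exact pow_le_pow_left₀ hδs.le (le_of_lt (not_le.1 h)) 2
      linarith only [h3, sq_nonneg x]

/-- Final bookkeeping: `rhs ≤ N Q`, `Q ≤ C' X`, `N C' ≤ C`, `0 ≤ X` give `rhs ≤ C X`. -/
theorem cm_arith_final {rhs N Q C' C X : ℝ} (hN : 0 ≤ N) (h1 : rhs ≤ N * Q) (h2 : Q ≤ C' * X)
    (h3 : N * C' ≤ C) (hX : 0 ≤ X) : rhs ≤ C * X := by
  have := mul_le_mul_of_nonneg_left h2 hN
  nlinarith

/-! ## The master inequality for one band and one diameter -/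

/-- **The cut-law master inequality, given the band data.** For `η₁ < η₀` in the smallness range
(`Z_cut ∈ (1/2, 3/2)`, `(ηZ)' ≥ 1/2` on `(0,η₁)`, `Z(η₁) ≥ 1/2`) and a smooth Gibbs/stable extension
`monatomicExcess χ f` agreeing with the cut law on the band `ρσ³ ≤ η₁`, `CutEosMasterFor σ η₁` holds. -/
theorem cm_cutEosMasterFor {η₀ η₁ σ : ℝ} {F χ f : ℝ → ℝ} (hF : AnalyticOnNhd ℝ F (Ioo (-η₀) η₀))
    (hEq : EqOn hsExcessFreeEnergy F (Ico 0 η₀)) (hη₁ : 0 < η₁) (hη₁₀ : η₁ < η₀) (hσ : 0 < σ)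
    (hagree : ∀ x, 0 < x → x * σ ^ 3 ≤ η₁ →
      cutCompressibility η₁ (x * σ ^ 3) = χ x ∧ cutExcessFreeEnergy η₁ (x * σ ^ 3) = f x)
    (hZcut : ∀ η, 0 < η → 1 / 2 < cutCompressibility η₁ η ∧ cutCompressibility η₁ η < 3 / 2)
    (hW' : ∀ η ∈ Ioo 0 η₁, (1 / 2 : ℝ) ≤ 1 + 2 * η * deriv F η + η ^ 2 * deriv (deriv F) η)
    (hZ1 : (1 / 2 : ℝ) ≤ 1 + η₁ * deriv F η₁)
    (hG : (EulerEOS.monatomicExcess χ f).IsGibbs)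
    (hS : (EulerEOS.monatomicExcess χ f).IsThermodynamicallyStable)
    (hp2 : ContDiffOn ℝ 2 (Function.uncurry (EulerEOS.monatomicExcess χ f).p) (Ioi 0 ×ˢ Ioi 0))
    (he2 : ContDiffOn ℝ 2 (Function.uncurry (EulerEOS.monatomicExcess χ f).e) (Ioi 0 ×ˢ Ioi 0))
    (hs2 : ContDiffOn ℝ 2 (Function.uncurry (EulerEOS.monatomicExcess χ f).s) (Ioi 0 ×ˢ Ioi 0))
    (hepos : ∀ r θ : ℝ, 0 < r → 0 < θ → 0 < (EulerEOS.monatomicExcess χ f).e r θ)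
    (hgrowth : ∃ c : ℝ, ∀ r θ : ℝ, 0 < r → 0 < θ →
      |(EulerEOS.monatomicExcess χ f).p r θ| ≤
        c * (1 + r + r * |(EulerEOS.monatomicExcess χ f).s r θ| +
          r * (EulerEOS.monatomicExcess χ f).e r θ)) :
    CutEosMasterFor σ η₁ := by
  intro K hK hKU M hM a b hab hδbox hdeep
  obtain ⟨δ, hδ, hbox⟩ := hδbox
  have hσ3 : 0 < σ ^ 3 := by positivity
  have hKq : K ⊆ Ioi 0 ×ˢ Ioi 0 := fun q hq => ⟨(hKU hq).1, (hKU hq).2.2⟩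
  obtain ⟨hG0, hS0, he0⟩ := cm_ideal_hypotheses
  -- constants of the smooth extension (BF master inequality) and of the ideal gas (coercivity)
  obtain ⟨δB, aB, bB, CB, hδB, -, hCB, hsB, hmaster⟩ :=
    master_pointwise_inequality hG hS hp2 he2 hs2 hepos hgrowth hK hKq hM
  obtain ⟨δ₀, c₀, -, hc₀, -, hcoer₀⟩ := EulerEOS.relEnergyThermo_coercivity_near_far hG0 hS0 hK hKq
  obtain ⟨Cd, hCd, hCd'⟩ := EulerEOS.density_le_of_relEnergyThermo hG0 hS0 hK hKq
  obtain ⟨Ce, hCe, hCe'⟩ := EulerEOS.energy_entropy_le_of_relEnergyThermo hG0 hS0 he0 hK hKq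
  -- bounds on `K`
  obtain ⟨Pk, hPk0, hPk⟩ := EulerEOS.exists_nonneg_forall_abs_le_of_continuousOn hK
    ((hG.1.continuousOn (s := Ioi 0 ×ˢ Ioi 0)).mono hKq)
  obtain ⟨S₀, hS₀0, hS₀⟩ := EulerEOS.exists_nonneg_forall_abs_le_of_continuousOn hK
    ((hG.2.2.1.continuousOn (s := Ioi 0 ×ˢ Ioi 0)).mono hKq)
  obtain ⟨S₁, hS₁0, hS₁⟩ := EulerEOS.exists_nonneg_forall_abs_le_of_continuousOn hK
    ((continuousOn_deriv_slice_fst hG.1 isOpen_quadrant le_rfl).mono hKq)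
  obtain ⟨S₂, hS₂0, hS₂⟩ := EulerEOS.exists_nonneg_forall_abs_le_of_continuousOn hK
    ((continuousOn_deriv_slice_snd hG.1 isOpen_quadrant le_rfl).mono hKq)
  obtain ⟨rmin, hrmin, hrminle⟩ :=
    hK.exists_forall_le' continuousOn_fst fun z hz => (hKq hz).1
  obtain ⟨pmin, hpmin, hpminle⟩ := hK.exists_forall_le'
    ((hG.1.continuousOn (s := Ioi 0 ×ˢ Ioi 0)).mono hKq) (a := 0) (by
      intro z hz
      obtain ⟨hz1, hzη, hz2⟩ := hKU hz
      show 0 < z.1 * z.2 * χ z.1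
      rw [← (hagree z.1 hz1 hzη.le).1]
      exact mul_pos (mul_pos hz1 hz2) (by linarith only [(hZcut _ (mul_pos hz1 hσ3)).1]))
  -- derived constants (kept opaque)
  obtain ⟨Zb, hZb⟩ : ∃ Zb : ℝ, Zb = max |a| |b| := ⟨_, rfl⟩
  have hZbb : ∀ x, |clamp a b x| ≤ Zb := fun x => hZb ▸ abs_clamp_le hab.le x
  obtain ⟨Sk, hSk⟩ : ∃ Sk : ℝ, Sk = S₀ + S₁ + S₂ := ⟨_, rfl⟩
  obtain ⟨A₁, hA₁⟩ : ∃ A₁ : ℝ, A₁ = 3 * M + (Sk + Zb) * M / 2 := ⟨_, rfl⟩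
  obtain ⟨A₂, hA₂⟩ : ∃ A₂ : ℝ, A₂ = 2 * Sk * (M + 3 * M * M) / rmin + (Sk + Zb) * (M + 3 * M * M) +
    3 / 2 * (Sk + Zb) * M := ⟨_, rfl⟩
  obtain ⟨A₃, hA₃⟩ : ∃ A₃ : ℝ, A₃ = 3 * M * Pk + 2 * Sk * (M + 3 * M * M) := ⟨_, rfl⟩
  have hZb0 : 0 ≤ Zb := (abs_nonneg _).trans (hZbb 0)
  have hSk0 : 0 ≤ Sk := by rw [hSk]; positivity
  have hA₁0 : 0 ≤ A₁ := by rw [hA₁]; positivity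
  have hA₂0 : 0 ≤ A₂ := by rw [hA₂]; positivity
  have hA₃0 : 0 ≤ A₃ := by rw [hA₃]; positivity
  obtain ⟨N, hN⟩ : ∃ N : ℝ, N = A₁ + A₂ + A₃ + 3 * M + 1 := ⟨_, rfl⟩
  have hN0 : 0 ≤ N := by rw [hN]; positivity
  have hA₃N : A₃ ≤ N := by rw [hN]; linarith only [hA₁0, hA₂0, hM]
  obtain ⟨δs, hδsdef⟩ : ∃ δs : ℝ, δs = min δ δB := ⟨_, rfl⟩
  have hδs : 0 < δs := by rw [hδsdef]; exact lt_min hδ hδB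
  have hδsδ : δs ≤ δ := hδsdef ▸ min_le_left _ _
  have hδsB : δs ≤ δB := hδsdef ▸ min_le_right _ _
  obtain ⟨c₁, hc₁⟩ : ∃ c₁ : ℝ, c₁ = min c₀ (c₀ * δs ^ 2) := ⟨_, rfl⟩
  have hc₁pos : 0 < c₁ := by rw [hc₁]; exact lt_min hc₀ (by positivity)
  obtain ⟨Cc, hCc⟩ : ∃ Cc : ℝ, Cc = 2 * (1 + 1 / pmin) := ⟨_, rfl⟩
  obtain ⟨Cr, hCr⟩ : ∃ Cr : ℝ, Cr = 2 + 2 * ((1 + Ce) * (1 + Cd) + Ce) * (1 / c₁ + 1) := ⟨_, rfl⟩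
  have hCc0 : 0 ≤ Cc := by rw [hCc]; positivity
  have hCr0 : 0 ≤ Cr := by rw [hCr]; positivity
  have hp0 : 0 ≤ 1 / pmin := by positivity
  obtain ⟨C, hC⟩ : ∃ C : ℝ, C = CB + N * (Cc + Cr + 1 / pmin) := ⟨_, rfl⟩
  have hNC1 := mul_nonneg hN0 hCc0
  have hNC2 := mul_nonneg hN0 hCr0
  have hNC3 := mul_nonneg hN0 hp0
  have hCexp : C = CB + N * Cc + N * Cr + N * (1 / pmin) := by rw [hC]; ring
  have hCpos : 0 < C := by rw [hCexp]; linarith only [hCB, hNC1, hNC2, hNC3]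
  have hCB_le : CB ≤ C := by rw [hCexp]; linarith only [hNC1, hNC2, hNC3]
  have hNCc_le : N * Cc ≤ C := by rw [hCexp]; linarith only [hNC2, hNC3, hCB]
  have hNCr_le : N * Cr ≤ C := by rw [hCexp]; linarith only [hNC1, hNC3, hCB]
  have hNp_le : N * (1 / pmin) ≤ C := by rw [hCexp]; linarith only [hNC1, hNC2, hCB]
  refine ⟨C, hCpos, fun d hdK hBd hmass hTeq w hw => ?_⟩
  -- the reference state: the cut law agrees with the extension near `d.r`
  obtain ⟨hr, hrη, hΘ⟩ := hKU hdK
  have hr' : d.r ≠ 0 := hr.ne'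
  have hχev : (fun x => cutCompressibility η₁ (x * σ ^ 3)) =ᶠ[𝓝 d.r] χ := by
    have hopen : IsOpen {x : ℝ | 0 < x ∧ x * σ ^ 3 < η₁} :=
      (isOpen_lt continuous_const continuous_id).inter
        (isOpen_lt (continuous_id.mul continuous_const) continuous_const)
    filter_upwards [hopen.mem_nhds ⟨hr, hrη⟩] with x hx
    exact (hagree x hx.1 hx.2.le).1
  obtain ⟨hχr, hfr⟩ := hagree d.r hr hrη.le
  obtain ⟨hpd, hsd, hpρd, hpϑd⟩ := cm_ref_transfer (f := f) hχev hχr hfr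
  have hPkd : |(cutEOS σ η₁).p d.r d.Θ| ≤ Pk := by rw [hpd]; exact hPk _ hdK
  have hSkd : |(cutEOS σ η₁).s d.r d.Θ| ≤ Sk := by
    rw [hsd]; exact (hS₀ _ hdK).trans (by rw [hSk]; linarith only [hS₁0, hS₂0])
  have hpρb : |d.pρ (cutEOS σ η₁)| ≤ Sk := by
    rw [hpρd]; exact (hS₁ _ hdK).trans (by rw [hSk]; linarith only [hS₀0, hS₂0])
  have hpϑb : |d.pϑ (cutEOS σ η₁)| ≤ Sk := by
    rw [hpϑd]; exact (hS₂ _ hdK).trans (by rw [hSk]; linarith only [hS₀0, hS₁0])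
  have hpmind : pmin ≤ (cutEOS σ η₁).p d.r d.Θ := by rw [hpd]; exact hpminle _ hdK
  have hrmind : rmin ≤ d.r := hrminle _ hdK
  rcases hw with rfl | ⟨hρ, hE⟩
  · -- the vacuum: `reducedRHS = p divU + Dₜp ≤ A₃ ≤ N`, `ℰ_Z = p(r,Θ) ≥ pmin`
    rw [cm_zero_phase.1, cm_zero_phase.2.1, cm_zero_phase.2.2, cm_relEnergyZ_zero]
    have hPw : |(cutEOS σ η₁).p 0 (stateTemp (cutEOS σ η₁) 0 0)| ≤ 0 := by
      show |0 * stateTemp (cutEOS σ η₁) 0 0 * cutCompressibility η₁ (0 * σ ^ 3)| ≤ 0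
      simp
    have h := cm_reducedRHS_le_lin (Z := clamp a b) (E := 0) (m := 0) hM hrmin hrmind le_rfl hBd hPkd
      hSkd hpρb hpϑb hZbb hPw
    rw [← hA₁, ← hA₂, ← hA₃] at h
    have h2 : reducedRHS (cutEOS σ η₁) (clamp a b) d 0 0 0 ≤ N := by
      refine h.trans ?_
      have e : A₁ * ((0 : ℝ) * ∑ i, ((0 : EuclideanSpace ℝ (Fin 3)) i / 0 - d.U i) ^ 2) + A₂ * 0 + A₃ +
          3 * M * 0 = A₃ := by ring
      rw [e]; exact hA₃N
    calc reducedRHS (cutEOS σ η₁) (clamp a b) d 0 0 0 ≤ N := h2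
      _ = N * (1 / pmin) * pmin := by field_simp
      _ ≤ C * (cutEOS σ η₁).p d.r d.Θ := mul_le_mul hNp_le hpmind hpmin.le hCpos.le
  · -- a state in the open quadrant
    have hst : stateTemp (cutEOS σ η₁) (dens w) (ien w) = 2 * ien w / (3 * dens w) := rfl
    have hstB : stateTemp (EulerEOS.monatomicExcess χ f) (dens w) (ien w) =
        stateTemp (cutEOS σ η₁) (dens w) (ien w) := rfl
    have hϑ : 0 < stateTemp (cutEOS σ η₁) (dens w) (ien w) := by rw [hst]; positivity
    have hEe : dens w * (cutEOS σ η₁).e (dens w) (stateTemp (cutEOS σ η₁) (dens w) (ien w)) = ien w := by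
      show dens w * (3 / 2 * (2 * ien w / (3 * dens w))) = ien w
      field_simp
    -- the linear bound on the reduced right-hand side
    have hPw : |(cutEOS σ η₁).p (dens w) (stateTemp (cutEOS σ η₁) (dens w) (ien w))| ≤ ien w := by
      show |dens w * (2 * ien w / (3 * dens w)) * cutCompressibility η₁ (dens w * σ ^ 3)| ≤ ien w
      have hz := hZcut (dens w * σ ^ 3) (mul_pos hρ hσ3)
      have e : dens w * (2 * ien w / (3 * dens w)) = 2 / 3 * ien w := by field_simp
      rw [e, abs_mul, abs_of_pos (by positivity : (0 : ℝ) < 2 / 3 * ien w),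
        abs_of_pos (by linarith only [hz.1] : (0 : ℝ) < cutCompressibility η₁ (dens w * σ ^ 3))]
      have h1 := mul_le_mul_of_nonneg_left hz.2.le (by positivity : (0 : ℝ) ≤ 2 / 3 * ien w)
      linarith only [h1]
    have hlin := cm_reducedRHS_le_lin (Z := clamp a b) (E := ien w) (m := mom w) hM hrmin hrmind hρ.le
      hBd hPkd hSkd hpρb hpϑb hZbb hPw
    rw [← hA₁, ← hA₂, ← hA₃] at hlin
    obtain ⟨Kin, hKin⟩ : ∃ Kin : ℝ, Kin = dens w / 2 * ∑ i, (mom w i / dens w - d.U i) ^ 2 := ⟨_, rfl⟩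
    have hKin0 : 0 ≤ Kin := by rw [hKin]; positivity
    have hKin2 : dens w * ∑ i, (mom w i / dens w - d.U i) ^ 2 = 2 * Kin := by rw [hKin]; ring
    rw [hKin2] at hlin
    have hQ : reducedRHS (cutEOS σ η₁) (clamp a b) d (dens w) (ien w) (mom w) ≤
        N * (2 * Kin + dens w + 1 + ien w) := by
      rw [hN]; exact hlin.trans (cm_arith_lin hA₁0 hA₂0 hA₃0 hM hKin0 hρ.le hE.le)
    -- the relative energy
    have hfull : relEnergyFull (cutEOS σ η₁) d (dens w) (ien w) (mom w) =
        Kin + (cutEOS σ η₁).relEnergyThermo d.r d.Θ (dens w) (stateTemp (cutEOS σ η₁) (dens w) (ien w)) := by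
      unfold relEnergyFull; rw [kinetic_eq d hρ.ne', hKin]
    have hZeq := relEnergyZ_eq (eos := cutEOS σ η₁) (clamp a b) d hr' hρ hEe
    by_cases hcold : (cutEOS σ η₁).s (dens w) (stateTemp (cutEOS σ η₁) (dens w) (ien w)) < a
    · -- the cold region `{s < a}`: the deep clamp
      have hcl : clamp a b ((cutEOS σ η₁).s (dens w) (stateTemp (cutEOS σ η₁) (dens w) (ien w))) = a := by
        simp only [clamp, min_eq_left (hcold.le.trans hab.le), max_eq_left hcold.le]
      have hX : Kin + ien w + dens w + pmin ≤ d.relEnergyZ (cutEOS σ η₁) (clamp a b) w := by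
        rw [cm_relEnergyZ_expand _ _ d hρ.ne', ← hKin, hcl]
        have h1 := mul_le_mul_of_nonneg_left (hdeep d.r d.Θ hdK) hρ.le
        have e : dens w * ((cutEOS σ η₁).chemPotential d.r d.Θ + d.Θ * a) =
            dens w * (cutEOS σ η₁).chemPotential d.r d.Θ + d.Θ * (dens w * a) := by ring
        linarith only [h1, e, hpmind]
      have hX0 : 0 ≤ d.relEnergyZ (cutEOS σ η₁) (clamp a b) w := by
        linarith only [hX, hKin0, hE.le, hρ.le, hpmin.le]
      exact cm_arith_final hN0 hQ (hCc ▸ cm_arith_cold hKin0 hE.le hρ.le hpmin hX) hNCc_le hX0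
    · have hsa : a ≤ (cutEOS σ η₁).s (dens w) (stateTemp (cutEOS σ η₁) (dens w) (ien w)) := not_lt.1 hcold
      have hXfull : relEnergyFull (cutEOS σ η₁) d (dens w) (ien w) (mom w) ≤
          d.relEnergyZ (cutEOS σ η₁) (clamp a b) w := by
        rw [hZeq]
        have h1 := mul_nonneg (mul_nonneg hΘ.le hρ.le) (sub_nonneg.2 (clamp_le_self (b := b) hsa))
        linarith only [h1]
      by_cases hnear : |dens w - d.r| ≤ δs ∧ |stateTemp (cutEOS σ η₁) (dens w) (ien w) - d.Θ| ≤ δs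
      · -- the essential region: transfer BF's master inequality from the smooth extension
        obtain ⟨-, -, hρη, hsa', hsb'⟩ := hbox d.r d.Θ (dens w) _ hdK (hnear.1.trans hδsδ)
          (hnear.2.trans hδsδ)
        obtain ⟨hsBa, hsBb⟩ := hsB d.r d.Θ (dens w) _ hdK (hnear.1.trans hδsB) (hnear.2.trans hδsB)
        obtain ⟨hχρ, hfρ⟩ := hagree (dens w) hρ hρη.le
        obtain ⟨hred, hfullB, hTiff⟩ :=
          cm_state_transfer (aB := aB) (bB := bB) hχev hχr hfr hχρ hfρ hsa'.le hsb'.le hsBa hsBb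
        have hm := hmaster d hdK hBd hmass (hTiff.1 hTeq) (dens w) (ien w) (mom w) hρ (hstB ▸ hϑ)
        have hfull0 : 0 ≤ relEnergyFull (cutEOS σ η₁) d (dens w) (ien w) (mom w) :=
          hfullB ▸ relEnergyFull_nonneg hG hS d hr hΘ hρ (hstB ▸ hϑ) (mom w)
        calc reducedRHS (cutEOS σ η₁) (clamp a b) d (dens w) (ien w) (mom w)
            ≤ CB * relEnergyFull (cutEOS σ η₁) d (dens w) (ien w) (mom w) := by rw [hred, ← hfullB]; exact hm
          _ ≤ C * relEnergyFull (cutEOS σ η₁) d (dens w) (ien w) (mom w) :=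
              mul_le_mul_of_nonneg_right hCB_le hfull0
          _ ≤ C * d.relEnergyZ (cutEOS σ η₁) (clamp a b) w := mul_le_mul_of_nonneg_left hXfull hCpos.le
      · -- the residual region: explicit coercivity of the cut law through the ideal gas
        have hcut := cm_relEnergyThermo_cut_ge hF hEq hη₁ hη₁₀ hσ (by norm_num : (1 / 2 : ℝ) ≤ 1) hW' hZ1
          hr hΘ hρ hϑ
        have hcf := hcoer₀ d.r d.Θ (dens w) (stateTemp (cutEOS σ η₁) (dens w) (ien w)) hdK hρ hϑ
        have hc₁R : c₁ ≤ (EulerEOS.monatomicExcess (fun _ => 1) (fun _ => 0)).relEnergyThermo d.r d.Θ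
            (dens w) (stateTemp (cutEOS σ η₁) (dens w) (ien w)) :=
          hc₁ ▸ cm_far_coercive hc₀ hδs hcf.1 hcf.2 hnear
        have hρC := hCd' d.r d.Θ (dens w) _ hdK hρ hϑ
        have hEC := (hCe' d.r d.Θ (dens w) _ hdK hρ hϑ).1
        have hEe0 : dens w * (EulerEOS.monatomicExcess (fun _ => 1) (fun _ => 0)).e (dens w)
            (stateTemp (cutEOS σ η₁) (dens w) (ien w)) = ien w := hEe
        rw [hEe0] at hEC
        have hX : Kin + (EulerEOS.monatomicExcess (fun _ => 1) (fun _ => 0)).relEnergyThermo d.r d.Θ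
            (dens w) (stateTemp (cutEOS σ η₁) (dens w) (ien w)) / 2 ≤
            d.relEnergyZ (cutEOS σ η₁) (clamp a b) w := by
          linarith only [hXfull, hfull, hcut]
        have hX0 : 0 ≤ d.relEnergyZ (cutEOS σ η₁) (clamp a b) w := by
          linarith only [hX, hKin0, hc₁pos.le.trans hc₁R]
        exact cm_arith_final hN0 hQ (hCr ▸ cm_arith_far hKin0 hc₁pos hCd.le hCe.le hc₁R hρC hEC hX)
          hNCr_le hX0

/-! ## The stub -/

/-- Smallness at `η = 0` of a function continuous at `0` with value `1`: it lies in `(1/2, 3/2)` on a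
symmetric interval. -/
theorem cm_near_one {g : ℝ → ℝ} (hg : ContinuousAt g 0) (h0 : g 0 = 1) :
    ∃ ε : ℝ, 0 < ε ∧ ∀ η : ℝ, |η| < ε → 1 / 2 < g η ∧ g η < 3 / 2 := by
  have hev : ∀ᶠ η in 𝓝 (0 : ℝ), 1 / 2 < g η ∧ g η < 3 / 2 :=
    (hg.eventually (lt_mem_nhds (by rw [h0]; norm_num))).and
      (hg.eventually (gt_mem_nhds (by rw [h0]; norm_num)))
  obtain ⟨ε, hε, h⟩ := Metric.eventually_nhds_iff.1 hev
  exact ⟨ε, hε, fun η hη => h (by simpa [Real.dist_eq] using hη)⟩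

/-- **S-M — BF's master pointwise inequality for the cut hard-sphere law with a deep clamp** (size M–L).
Under `HsEosLowDensity` there is `ηm > 0` such that `CutEosMasterFor σ η₁` holds for every band `0 < η₁ < ηm`
and every reduced diameter `σ > 0`: `ηm = min(ε₁, ε₂, η₂)` where `(ηZ)' ∈ (1/2,3/2)` on `|η| < ε₁`,
`Z ∈ (1/2, 3/2)` on `|η| < ε₂` (continuity at `η = 0` of the analytic germ, `Z(0) = 1`) and `η₂` is the
`σ`-independent band edge of the smooth extension `cm_band_extension`; then `cm_cutEosMasterFor` applies. -/
theorem stub_cutEosMaster :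
    HsEosLowDensity →
      ∃ ηm : ℝ, 0 < ηm ∧ ∀ η₁ : ℝ, 0 < η₁ → η₁ < ηm → ∀ σ : ℝ, 0 < σ → CutEosMasterFor σ η₁ := by
  rintro ⟨η₀, hη₀, F, hF, hEq, -, -, -⟩
  -- smallness scales of `(ηZ)' = 1 + 2ηF' + η²F''` and `Z = 1 + ηF'` at `η = 0`
  have h0U : (0 : ℝ) ∈ Ioo (-η₀) η₀ := ⟨by linarith, hη₀⟩
  have hF1c : ContinuousAt (deriv F) 0 := hF.deriv.continuousOn.continuousAt (isOpen_Ioo.mem_nhds h0U)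
  have hF2c : ContinuousAt (deriv (deriv F)) 0 :=
    hF.deriv.deriv.continuousOn.continuousAt (isOpen_Ioo.mem_nhds h0U)
  obtain ⟨ε₁, hε₁, hW⟩ := cm_near_one (g := fun η => 1 + 2 * η * deriv F η + η ^ 2 * deriv (deriv F) η)
    (by fun_prop) (by simp)
  obtain ⟨ε₂, hε₂, hZf⟩ := cm_near_one (g := fun η => 1 + η * deriv F η) (by fun_prop) (by simp)
  -- the smooth band extension, with a `σ`-independent band edge
  obtain ⟨η₂, hη₂, hη₂η₀, hext⟩ := cm_band_extension hη₀ hF hEq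
  refine ⟨min (min ε₁ ε₂) η₂, lt_min (lt_min hε₁ hε₂) hη₂, fun η₁ hη₁ hη₁m σ hσ => ?_⟩
  have hη₁ε₁ : η₁ < ε₁ := hη₁m.trans_le ((min_le_left _ _).trans (min_le_left _ _))
  have hη₁ε₂ : η₁ < ε₂ := hη₁m.trans_le ((min_le_left _ _).trans (min_le_right _ _))
  have hη₁₂ : η₁ ≤ η₂ := (hη₁m.trans_le (min_le_right _ _)).le
  have hη₁₀ : η₁ < η₀ := by linarith
  obtain ⟨χ, f, hχc, hfc, hvir, hstab, ⟨B, hB⟩, hband⟩ := hext σ hσ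
  obtain ⟨hG, hS, hp2, he2, hs2, hepos, -, hgrowth⟩ :=
    monatomicExcess_bf_hypotheses χ f hχc hfc hvir hstab hB
  -- the cut law agrees with the extension on the band
  have hagree : ∀ x, 0 < x → x * σ ^ 3 ≤ η₁ →
      cutCompressibility η₁ (x * σ ^ 3) = χ x ∧ cutExcessFreeEnergy η₁ (x * σ ^ 3) = f x := by
    intro x hx hxη
    obtain ⟨hf, hχ⟩ := hband x hx (hxη.trans hη₁₂)
    exact ⟨by rw [hχ, cm_cutZ_of_le hxη], by rw [hf, cm_cutF_of_le hη₁ hxη]⟩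
  -- the cut compressibility is pinched in `(1/2, 3/2)`
  have hZcut : ∀ η, 0 < η → 1 / 2 < cutCompressibility η₁ η ∧ cutCompressibility η₁ η < 3 / 2 := by
    intro η hη
    have hm0 : 0 < min η η₁ := lt_min hη hη₁
    have hm1 : min η η₁ ≤ η₁ := min_le_right _ _
    have h := hZf (min η η₁) (by rw [abs_of_pos hm0]; linarith)
    rwa [cutCompressibility, hsCompressibility_eq hEq ⟨hm0, hm1.trans_lt hη₁₀⟩]
  have hW' : ∀ η ∈ Ioo 0 η₁, (1 / 2 : ℝ) ≤ 1 + 2 * η * deriv F η + η ^ 2 * deriv (deriv F) η :=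
    fun η hη => (hW η (by rw [abs_of_pos hη.1]; linarith [hη.2])).1.le
  have hZ1 : (1 / 2 : ℝ) ≤ 1 + η₁ * deriv F η₁ := (hZf η₁ (by rw [abs_of_pos hη₁]; linarith)).1.le
  exact cm_cutEosMasterFor hF hEq hη₁ hη₁₀ hσ hagree hZcut hW' hZ1 hG hS hp2 he2 hs2 hepos hgrowth

end Summit.AtomisticToContinuum.HydrodynamicLimit.Theorems.RES

end
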